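import Literature.IUT.HodgeArakelov.BadPrimeGaussianMonoidsGaloisKummerHomProofs
import Literature.IUT.HodgeArakelov.BadPrimeGaussianMonoidsCohomologyModelProofs3
import Literature.IUT.HodgeArakelov.ThetaEnvDataRecordModel
import Literature.IUT.HodgeArakelov.BadPrimeGaussianMonoidsSyncInftyTorsionProofs
import Literature.IUT.HodgeArakelov.BadPrimeGaussianMonoidsProofs5

/-!
# [IUTchII] Cor 3.5 (ii) «↠ / ⥤» at the `∞`-level and Rmk 3.6.1 (equivariance of the restriction isomorphism), from the
# Kummer map with EXPLICIT action — label-wise model AND the genuine record `EtaleLevels.thetaEnvRecordKummer` (proof-only)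

S. Mochizuki, *Inter-universal Teichmüller theory II*, kurims Dec-2020 manuscript, Cor 3.5 (ii) p. 95 ("each of `∞Ψ_ξ(M^Θ_*)`,
`Ψ_ξ(M^Θ_*)` is equipped with a natural action by `G_v(M^Θ_*▶)_{⟨F_l^⋇⟩}`", "up to multiplication by an element of the
`N`-torsion subgroup"), Rmk 3.6.1 p. 101 (the restriction isomorphism `Ψ^ξ_{F_ξ}(𝔻) ⥲ Ψ_{F_ξ}(M^Θ_*)` is
`G_v,⟨F_l^⋇⟩`-equivariant), Prop 1.4 p. 27 (`∞θ`: "some positive power coincides, up to torsion, with an element of `θ`")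
[cite: Mochizuki2012, Cor 3.5 (ii) p.95]. Claim key DISPUTED (D-0012). PROOF-ONLY companion (abc-iut cell, layer L6, seat
abc-iut-w4-d004 gen 2; node **IUTchII:Cor3.5(ii)**; sub-DAG rows Cor-35.ii.r10/r11, Rmk-361). NO definition, NO `Prop` fact.

CONTENT. `…GaloisKummerHomProofs.lean` / `…GenuineRecordGaloisProofs.lean` discharged every junction hypothesis of the
`Ψ`-level Galois clause at the label-wise Kummer-hom model and at the genuine record. This file does the same for the two
remaining printed clauses of the family that only use the `Ψ`-level synchronization:
* `restrictionIso'_equivariant_ofKummerHom_labelwise` — **Rmk 3.6.1**: any monoid isomorphism `e : M^×_TM·θ^ℕ ⥲ S'` that is the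
  product restriction `∏_t R_t` on elements (the restriction isomorphism of Cor 3.5 (ii)/Cor 3.6 (ii)) intertwines the action of
  `G_v` through the section `s_{t₀}` with the DIAGONAL action — `hstab`, `hr`, `hsync` all DERIVED (abc-iut-w4-d034's
  `restrictionIso'_equivariant` fed with the Kummer-hom synchronization);
* `pi_restriction_inftyThetaMonoid_upToTorsion_ofKummerHom_labelwise` — **Cor 3.5 (ii) at `∞Ψ^ι_env`, faithful (torsion)
  form**: for `x ∈ ∞Ψ^ι_env = M^×_TM·⟨∞θ^ι_env⟩`, the product restriction of `s_{t₀}(g)·x` equals the diagonal translate of the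
  product restriction of `x` UP TO a family of `N`-torsion classes (`x^N ∈ M^×_TM·θ^ℕ`), given print's root condition on the
  generators `∞θ^ι_env` (p. 27, hypothesis `hroots`, relative to `θ`) — abc-iut-w5-d131's generic
  `pi_conj_eq_mul_piIso_upToTorsion` / `exists_pow_mem_of_mem_splitMonoid_closure` fed with the derived `hr` and the
  Kummer-hom synchronization on `M^×_TM·θ^ℕ`;
* `restrictionIso'_equivariant_thetaEnvRecordKummer_of_mem_thetaEnv`,
  `pi_restriction_inftyThetaMonoid_upToTorsion_thetaEnvRecordKummer_of_mem_thetaEnv` — the same two clauses **AT THE GENUINE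
  RECORD** `EtaleLevels.thetaEnvRecordKummer` (abc-iut-w4-d019), for every `θ ∈ θ^ι_env(𝕄_*)`, with the tautological
  identification (`j = id`, `ψ = Additive (Multiplicative lim) ≃ lim`, `ρ := MulDistribMulAction.toMulAut`,
  `κ := h1LimKummerOn`): inputs = the evaluation-sections DATA (`s_t`, `φ₀`, `q`, `w`, `R_t` pinned), the model data
  (`c`, `O`, `hO`), and — for the `∞`-level only — print's root condition `hroots`.

Nothing here asserts a disputed claim or takes a side on [IUTchIII] Cor 3.12; typed ≠ proved ≠ endorsed.
-/

noncomputable section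

namespace Literature.IUT.HodgeArakelov

universe u v w

namespace BadPrimeGaussianMonoids

open CohomologySystemOfContH1 TemperedThetaMonoids

section LabelwiseInfty

variable {Q : Type u} [Group Q] (E : TemperedThetaMonoids.ThetaEnvData.{u, v} Q)
  {A : Type w} [CommGroup A] (ρ : Q →* MulAut A) (O : Submonoid A)
  (hO : ∀ (σ : Q) (b : A), b ∈ O → ρ σ b ∈ O) (κ : O →* E.H)
  {P₀ P : TopGroup.{u}} {G' : Type u} [Group G'] [TopologicalSpace G'] [IsTopologicalGroup G']
  (φ : P →* G') (φ₀ : P₀ →* G') (Am : Subgroup G') [Am.Normal] [IsMulCommutative Am] (N : Subgroup P) [N.Normal]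
  (j : Q →* P) (ψ : Additive E.H ≃+ h1Lim φ Am N ⊥) {L : Type*} (s : L → (P₀ →* Q))
  (hι : ∀ t, Continuous (j.comp (s t))) (hN : ∀ t, (⊤ : Subgroup P₀).map (j.comp (s t)) ≤ N)
  (hφ : ∀ t, φ.comp (j.comp (s t)) = φ₀)

include hN in
/-- `Ψ`-level conjugate synchronization on `M^×_TM · θ^ℕ` at the label-wise Kummer-hom model: the units by the Kummer map of a
module of constants on which `Ker q` acts trivially (sections `s_t` of `q`), the class `θ` by `hfix` (top-level class).
[cite: Mochizuki2012, Cor 3.5 (ii) p.95] -/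
theorem sync_thetaSplit_ofKummerHom_labelwise (hcns : E.constantMonoid = MonoidHom.mrange κ)
    (hκeq : ∀ (σ : Q) (m : O), κ ⟨ρ σ (m : A), hO σ m m.2⟩ = E.conj σ (κ m))
    {K : Type*} [Group K] (q : Q →* K) (hq : ∀ x : Q, q x = 1 → ∀ a ∈ O, ρ x a = a) (w : P₀ →* K)
    (hsec : ∀ t g, q (s t g) = w g)
    (hψ : ∀ (p : Q) (y : E.H),
      ψ (Additive.ofMul (E.conj p y)) = h1LimConj φ Am N (j p) (ψ (Additive.ofMul y)))
    (θ : E.H) (hθ : ψ (Additive.ofMul θ) ∈ Set.range ((cohomologySystemOfContH1 φ Am N).toLim ⊤)) :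
    ∀ g t t', ∀ x ∈ splitMonoid E.units (Submonoid.powers θ), E.conj (s t g) x = E.conj (s t' g) x := by
  have hfix : ∀ g t, E.conj (s t g) θ = θ := conj_section_eq_self_labelwise E φ Am N j ψ s hN hψ hθ
  exact sync_splitMonoid E.conj s E.units θ
    (sync_units_of_sections_kummerHom E ρ O hO κ hcns hκeq q.ker
      (fun δ hδ a ha => hq δ (MonoidHom.mem_ker.mp hδ) a ha) s
      (sections_mk_eq_of_isSection s q q.ker (fun x hx => MonoidHom.mem_ker.mpr hx) w hsec))
    (fun g t t' => by rw [hfix, hfix])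

/-- **IUTchII:Rmk3.6.1** (kurims p.101) at the label-wise Kummer-hom model: any monoid isomorphism `e` out of `M^×_TM · θ^ℕ`
which is the product restriction `∏_t R_t` on elements (the restriction isomorphism of Cor 3.5 (ii) / Cor 3.6 (ii)) is
`G_v,⟨F_l^⋇⟩`-EQUIVARIANT: it carries the action through the section `s_{t₀}` (any `t₀`; membership `hx` by
`thetaSplit_conjStable_ofKummerHom`) to the DIAGONAL action — `hstab`, `hr`, `hsync` derived.
[cite: Mochizuki2012, Rmk 3.6.1 p.101] -/
theorem restrictionIso'_equivariant_ofKummerHom_labelwise (hcns : E.constantMonoid = MonoidHom.mrange κ)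
    (hκeq : ∀ (σ : Q) (m : O), κ ⟨ρ σ (m : A), hO σ m m.2⟩ = E.conj σ (κ m))
    {K : Type*} [Group K] (q : Q →* K) (hq : ∀ x : Q, q x = 1 → ∀ a ∈ O, ρ x a = a) (w : P₀ →* K)
    (hsec : ∀ t g, q (s t g) = w g)
    (hψ : ∀ (p : Q) (y : E.H),
      ψ (Additive.ofMul (E.conj p y)) = h1LimConj φ Am N (j p) (ψ (Additive.ofMul y)))
    (θ : E.H) (hθ : ψ (Additive.ofMul θ) ∈ Set.range ((cohomologySystemOfContH1 φ Am N).toLim ⊤))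
    (R : L → (E.H →* Multiplicative (h1Lim φ₀ Am (⊤ : Subgroup P₀) ⊥)))
    (hR : ∀ t y, Multiplicative.toAdd (R t y) =
      h1LimCongr Am ⊤ (hφ t) ⊥ (h1LimComap φ Am (j.comp (s t)) (hι t) (hN t) (ψ (Additive.ofMul y))))
    {S' : Submonoid (L → Multiplicative (h1Lim φ₀ Am (⊤ : Subgroup P₀) ⊥))}
    (e : splitMonoid E.units (Submonoid.powers θ) ≃* S')
    (he : ∀ x : splitMonoid E.units (Submonoid.powers θ), ((e x : S') : L → _) =
      MonoidHom.pi (fun t => (R t).comp (splitMonoid E.units (Submonoid.powers θ)).subtype) x)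
    (t₀ : L) (g : P₀) (x : splitMonoid E.units (Submonoid.powers θ))
    (hx : E.conj (s t₀ g) (x : E.H) ∈ splitMonoid E.units (Submonoid.powers θ)) :
    ((e ⟨E.conj (s t₀ g) (x : E.H), hx⟩ : S') : L → _) = piIso L (h1LimConjMulAut φ₀ Am ⊤ g) (e x : L → _) :=
  restrictionIso'_equivariant E.conj s (h1LimConjMulAut φ₀ Am ⊤) (splitMonoid E.units (Submonoid.powers θ))
    (fun t => (R t).comp (splitMonoid E.units (Submonoid.powers θ)).subtype)
    (thetaSplit_conjStable_ofKummerHom E ρ O hO κ hcns hκeq s θ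
      (conj_section_eq_self_labelwise E φ Am N j ψ s hN hψ hθ))
    (fun t g' y => restriction_conj_section_eq_labelwise E φ φ₀ Am N j ψ s hι hN hφ hψ R hR t g' (y : E.H))
    (sync_thetaSplit_ofKummerHom_labelwise E ρ O hO κ φ Am N j ψ s hN hcns hκeq q hq w hsec hψ θ hθ) e he t₀ g x

/-- **IUTchII:Cor3.5(ii)** (kurims p.95) at `∞Ψ^ι_env(M^Θ_*) = M^×_TM · ⟨∞θ^ι_env⟩`, FAITHFUL (torsion) form, at the
label-wise Kummer-hom model: for `x ∈ ∞Ψ^ι_env` the product restriction of `s_{t₀}(g)·x` is the DIAGONAL translate of the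
product restriction of `x` up to a family of `N`-torsion classes, `N > 0` with `x^N ∈ M^×_TM · θ^ℕ` — given print's root
condition `hroots` on the generators (p. 27); `hr` and the `Ψ`-level synchronization DERIVED.
[cite: Mochizuki2012, Cor 3.5 (ii) p.95] -/
theorem pi_restriction_inftyThetaMonoid_upToTorsion_ofKummerHom_labelwise (hcns : E.constantMonoid = MonoidHom.mrange κ)
    (hκeq : ∀ (σ : Q) (m : O), κ ⟨ρ σ (m : A), hO σ m m.2⟩ = E.conj σ (κ m))
    {K : Type*} [Group K] (q : Q →* K) (hq : ∀ x : Q, q x = 1 → ∀ a ∈ O, ρ x a = a) (w : P₀ →* K)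
    (hsec : ∀ t g, q (s t g) = w g)
    (hψ : ∀ (p : Q) (y : E.H),
      ψ (Additive.ofMul (E.conj p y)) = h1LimConj φ Am N (j p) (ψ (Additive.ofMul y)))
    (ι : E.Iota) (θ : E.H) (hθ : ψ (Additive.ofMul θ) ∈ Set.range ((cohomologySystemOfContH1 φ Am N).toLim ⊤))
    (hroots : ∀ ϑ ∈ E.inftyThetaEnv ι, ∃ N : ℕ, 0 < N ∧ ϑ ^ N ∈ splitMonoid E.units (Submonoid.powers θ))
    (R : L → (E.H →* Multiplicative (h1Lim φ₀ Am (⊤ : Subgroup P₀) ⊥)))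
    (hR : ∀ t y, Multiplicative.toAdd (R t y) =
      h1LimCongr Am ⊤ (hφ t) ⊥ (h1LimComap φ Am (j.comp (s t)) (hι t) (hN t) (ψ (Additive.ofMul y))))
    {x : E.H} (hx : x ∈ E.inftyThetaMonoid ι) (t₀ : L) (g : P₀) :
    ∃ (n : ℕ) (u : L → E.H), 0 < n ∧ (∀ t, u t ^ n = 1) ∧
      MonoidHom.pi R (E.conj (s t₀ g) x) =
        (fun t => R t (u t)) * piIso L (h1LimConjMulAut φ₀ Am ⊤ g) (MonoidHom.pi R x) := by
  obtain ⟨n, hn, hxn⟩ := exists_pow_mem_of_mem_splitMonoid_closure E.units (E.inftyThetaEnv ι)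
    (splitMonoid E.units (Submonoid.powers θ))
    (fun u hu => (mem_splitMonoid_iff _ _ _).mpr ⟨u, hu, 1, Submonoid.one_mem _, mul_one u⟩) hroots x hx
  obtain ⟨u, hu, h⟩ := pi_conj_eq_mul_piIso_upToTorsion E.conj s (h1LimConjMulAut φ₀ Am ⊤) R
    (fun t g' y => restriction_conj_section_eq_labelwise E φ φ₀ Am N j ψ s hι hN hφ hψ R hR t g' y)
    (splitMonoid E.units (Submonoid.powers θ))
    (sync_thetaSplit_ofKummerHom_labelwise E ρ O hO κ φ Am N j ψ s hN hcns hκeq q hq w hsec hψ θ hθ) hxn t₀ g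
  exact ⟨n, u, hn, hu, h⟩

end LabelwiseInfty

end BadPrimeGaussianMonoids

/-! ### At the genuine record `EtaleLevels.thetaEnvRecordKummer` -/

namespace EtaleLevels

open Literature.AnabelianGeometry.EtaleTheta CohomologySystemOfContH1 EtaleThetaDataOfSetting TemperedThetaMonoids
  BadPrimeGaussianMonoids

variable {p : ℕ} [Fact p.Prime] {D : Literature.AnabelianGeometry.EtaleTheta.ThetaSetting p}
  {E : D.EtaleThetaData} {l : ℕ} (C : E.DoubleUnderline l) (hC : D.Compat) (hS : D.Sec2Hyps)
  (hl : l.Prime) (hp2 : p ≠ 2) (hpl : p ≠ l) (hζ : ∃ ζ : D.K, IsPrimitiveRoot ζ (4 * l))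
  (mods : ∀ M : ℕ+, D.CyclotomeMod l M)
  (f : contCocycles D.toTheta D.DeltaTheta C.GtpYdduu) (hf : f ∈ C.rootCocycles hC)
  (hmods : ∀ (M M' : ℕ+) (h : (M : ℕ) ∣ (M' : ℕ)) (x : D.lDeltaTheta l),
    MuN.red p M M' h ((mods M').red x) = (mods M).red x)
  (h15 : Literature.AnabelianGeometry.EtaleTheta.ThetaSetting.Prop15iii E hC) (L : C.CuspLabels)
  (hZ : ∀ M : ℕ+, Nonempty (ModelCyclotomes.lDeltaQuot (C.rigidData (mods M) hC hS h15 L) ≃*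
    Literature.IUT.HodgeTheaters.ZHat))
  (hcharY : EtaleThetaDataOfSetting.PiYddCharacteristic C)
  (hlim : Function.Bijective (rigidLimHom C hC hS hl hp2 hpl hζ mods f hf hmods h15 L hZ))
  [(EtaleThetaDataOfSetting.PiYdd C).Normal]
  {A : Type} [CommGroup A] [MulDistribMulAction (Pi C) A] [TopologicalSpace A] [RootableBy A ℕ]
  (c : CyclotomeCoefficients (phi C) (D.lDeltaTheta l) A)
  (hA : ∀ b : A, IsOpen (MulAction.stabilizer (Pi C) b : Set (Pi C)))
  (hfi : ∀ b : A, (MulAction.stabilizer (Pi C) b).FiniteIndex)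
  (O : Submonoid A) (hO : ∀ (σ : Pi C) (b : A), b ∈ O → σ • b ∈ O) (ι₀ : Pi C)
  {Lbl : Type*} {P₀ : TopGroup.{0}} (φ₀ : P₀ →* D.GtpTheta) (s : Lbl → (P₀ →* Pi C))
  (hι : ∀ t, Continuous ((MonoidHom.id (Pi C)).comp (s t)))
  (hN : ∀ t, (⊤ : Subgroup P₀).map ((MonoidHom.id (Pi C)).comp (s t)) ≤ PiYdd C)
  (hφ : ∀ t, (phi C).comp ((MonoidHom.id (Pi C)).comp (s t)) = φ₀)

include hO in
/-- **IUTchII:Rmk3.6.1** (kurims p.101) **AT THE GENUINE RECORD**: for every `θ ∈ θ^ι_env(𝕄_*)`, any restriction isomorphism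
`e` out of `M^×_TM · θ^ℕ` (product restriction on elements) intertwines the action of `G_v` through the section `s_{t₀}` with
the DIAGONAL action; inputs = evaluation-sections data + model data. [cite: Mochizuki2012, Rmk 3.6.1 p.101] -/
theorem restrictionIso'_equivariant_thetaEnvRecordKummer_of_mem_thetaEnv
    {K : Type*} [Group K] (q : Pi C →* K) (hq : ∀ x : Pi C, q x = 1 → ∀ a ∈ O, x • a = a) (w : P₀ →* K)
    (hsec : ∀ t g, q (s t g) = w g) {i₀ : Pi C}
    {θ : (thetaEnvRecordKummer C hC hS hl hp2 hpl hζ mods f hf hmods h15 L hZ hcharY hlim c hA hfi O ι₀).H}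
    (hθ : θ ∈ (thetaEnvRecordKummer C hC hS hl hp2 hpl hζ mods f hf hmods h15 L hZ hcharY hlim c hA hfi O ι₀).thetaEnv i₀)
    (R : Lbl → ((thetaEnvRecordKummer C hC hS hl hp2 hpl hζ mods f hf hmods h15 L hZ hcharY hlim c hA hfi O ι₀).H →*
      Multiplicative (h1Lim φ₀ (D.lDeltaTheta l) (⊤ : Subgroup P₀) ⊥)))
    (hR : ∀ t y, Multiplicative.toAdd (R t y) =
      h1LimCongr (D.lDeltaTheta l) ⊤ (hφ t) ⊥
        (h1LimComap (phi C) (D.lDeltaTheta l) ((MonoidHom.id (Pi C)).comp (s t)) (hι t) (hN t)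
          (AddEquiv.additiveMultiplicative (h1Lim (phi C) (D.lDeltaTheta l) (PiYdd C) ⊥) (Additive.ofMul y))))
    {S' : Submonoid (Lbl → Multiplicative (h1Lim φ₀ (D.lDeltaTheta l) (⊤ : Subgroup P₀) ⊥))}
    (e : splitMonoid (thetaEnvRecordKummer C hC hS hl hp2 hpl hζ mods f hf hmods h15 L hZ hcharY hlim c hA hfi O ι₀).units
      (Submonoid.powers θ) ≃* S')
    (he : ∀ x, ((e x : S') : Lbl → _) = MonoidHom.pi (fun t => (R t).comp (splitMonoid
      (thetaEnvRecordKummer C hC hS hl hp2 hpl hζ mods f hf hmods h15 L hZ hcharY hlim c hA hfi O ι₀).units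
      (Submonoid.powers θ)).subtype) x)
    (t₀ : Lbl) (g : P₀)
    (x : splitMonoid (thetaEnvRecordKummer C hC hS hl hp2 hpl hζ mods f hf hmods h15 L hZ hcharY hlim c hA hfi O ι₀).units
      (Submonoid.powers θ))
    (hx : (thetaEnvRecordKummer C hC hS hl hp2 hpl hζ mods f hf hmods h15 L hZ hcharY hlim c hA hfi O ι₀).conj (s t₀ g)
      (x : (thetaEnvRecordKummer C hC hS hl hp2 hpl hζ mods f hf hmods h15 L hZ hcharY hlim c hA hfi O ι₀).H) ∈
      splitMonoid (thetaEnvRecordKummer C hC hS hl hp2 hpl hζ mods f hf hmods h15 L hZ hcharY hlim c hA hfi O ι₀).units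
        (Submonoid.powers θ)) :
    ((e ⟨_, hx⟩ : S') : Lbl → _) = piIso Lbl (h1LimConjMulAut φ₀ (D.lDeltaTheta l) ⊤ g) (e x : Lbl → _) :=
  restrictionIso'_equivariant_ofKummerHom_labelwise
    (thetaEnvRecordKummer C hC hS hl hp2 hpl hζ mods f hf hmods h15 L hZ hcharY hlim c hA hfi O ι₀)
    (MulDistribMulAction.toMulAut (Pi C) A) O (fun σ b hb => hO σ b hb)
    (h1LimKummerOn (phi C) (D.lDeltaTheta l) (PiYdd C) c hA hfi O) (phi C) φ₀ (D.lDeltaTheta l) (PiYdd C)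
    (MonoidHom.id (Pi C)) (AddEquiv.additiveMultiplicative (h1Lim (phi C) (D.lDeltaTheta l) (PiYdd C) ⊥)) s hι hN hφ
    (ThetaEnvData.toRecord_constantMonoid _ _ _ _)
    (fun (σ : Pi C) m => h1LimKummerOn_smul (phi C) (D.lDeltaTheta l) (PiYdd C) c hA hfi O σ m
      ⟨σ • (m : A), hO σ m m.2⟩ rfl)
    q (fun x hx a ha => hq x hx a ha) w hsec
    (fun _ _ => rfl) θ
    (toRecord_topClass (thetaEnvData C hC hS hl hp2 hpl hζ mods f hf hmods h15 L hZ hcharY hlim)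
      (CohomologySystemOfContH1.h1LimConjMulAut (phi C) (D.lDeltaTheta l) (PiYdd C))
      (h1LimKummerOn (phi C) (D.lDeltaTheta l) (PiYdd C) c hA hfi O)
      (fun g : Pi C => h1LimConjEquiv (phi C) (D.lDeltaTheta l) (PiYdd C) (g * ι₀ * g⁻¹))
      (phi C) (D.lDeltaTheta l) (PiYdd C)
      (AddEquiv.additiveMultiplicative (h1Lim (phi C) (D.lDeltaTheta l) (PiYdd C) ⊥)) (fun y _ => ⟨y, rfl⟩) hθ)
    R hR e he t₀ g x hx

include hO in
/-- **IUTchII:Cor3.5(ii)** (kurims p.95) at `∞Ψ^ι_env(𝕄_*)`, FAITHFUL (torsion) form, **AT THE GENUINE RECORD**: for every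
`θ ∈ θ^ι_env(𝕄_*)` and `x ∈ ∞Ψ^{i}_env = M^×_TM · ⟨∞θ^{i}_env⟩`, the product restriction of `s_{t₀}(g)·x` is the diagonal
translate of the product restriction of `x` up to a family of `n`-torsion classes (`n > 0`, `x^n ∈ M^×_TM · θ^ℕ`), given
print's root condition `hroots` on the generators `∞θ^{i}_env` (Prop 1.4 p. 27); inputs = evaluation-sections data + model
data + `hroots`. [cite: Mochizuki2012, Cor 3.5 (ii) p.95] -/
theorem pi_restriction_inftyThetaMonoid_upToTorsion_thetaEnvRecordKummer_of_mem_thetaEnv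
    {K : Type*} [Group K] (q : Pi C →* K) (hq : ∀ x : Pi C, q x = 1 → ∀ a ∈ O, x • a = a) (w : P₀ →* K)
    (hsec : ∀ t g, q (s t g) = w g) {i₀ : Pi C}
    {θ : (thetaEnvRecordKummer C hC hS hl hp2 hpl hζ mods f hf hmods h15 L hZ hcharY hlim c hA hfi O ι₀).H}
    (hθ : θ ∈ (thetaEnvRecordKummer C hC hS hl hp2 hpl hζ mods f hf hmods h15 L hZ hcharY hlim c hA hfi O ι₀).thetaEnv i₀)
    (i : (thetaEnvRecordKummer C hC hS hl hp2 hpl hζ mods f hf hmods h15 L hZ hcharY hlim c hA hfi O ι₀).Iota)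
    (hroots : ∀ ϑ ∈ (thetaEnvRecordKummer C hC hS hl hp2 hpl hζ mods f hf hmods h15 L hZ hcharY hlim c hA hfi O ι₀).inftyThetaEnv i,
      ∃ n : ℕ, 0 < n ∧ ϑ ^ n ∈
        splitMonoid (thetaEnvRecordKummer C hC hS hl hp2 hpl hζ mods f hf hmods h15 L hZ hcharY hlim c hA hfi O ι₀).units
          (Submonoid.powers θ))
    (R : Lbl → ((thetaEnvRecordKummer C hC hS hl hp2 hpl hζ mods f hf hmods h15 L hZ hcharY hlim c hA hfi O ι₀).H →*
      Multiplicative (h1Lim φ₀ (D.lDeltaTheta l) (⊤ : Subgroup P₀) ⊥)))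
    (hR : ∀ t y, Multiplicative.toAdd (R t y) =
      h1LimCongr (D.lDeltaTheta l) ⊤ (hφ t) ⊥
        (h1LimComap (phi C) (D.lDeltaTheta l) ((MonoidHom.id (Pi C)).comp (s t)) (hι t) (hN t)
          (AddEquiv.additiveMultiplicative (h1Lim (phi C) (D.lDeltaTheta l) (PiYdd C) ⊥) (Additive.ofMul y))))
    {x : (thetaEnvRecordKummer C hC hS hl hp2 hpl hζ mods f hf hmods h15 L hZ hcharY hlim c hA hfi O ι₀).H}
    (hx : x ∈ (thetaEnvRecordKummer C hC hS hl hp2 hpl hζ mods f hf hmods h15 L hZ hcharY hlim c hA hfi O ι₀).inftyThetaMonoid i)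
    (t₀ : Lbl) (g : P₀) :
    ∃ (n : ℕ) (u : Lbl → (thetaEnvRecordKummer C hC hS hl hp2 hpl hζ mods f hf hmods h15 L hZ hcharY hlim c hA hfi O ι₀).H),
      0 < n ∧ (∀ t, u t ^ n = 1) ∧
      MonoidHom.pi R
          ((thetaEnvRecordKummer C hC hS hl hp2 hpl hζ mods f hf hmods h15 L hZ hcharY hlim c hA hfi O ι₀).conj (s t₀ g) x) =
        (fun t => R t (u t)) * piIso Lbl (h1LimConjMulAut φ₀ (D.lDeltaTheta l) ⊤ g) (MonoidHom.pi R x) :=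
  pi_restriction_inftyThetaMonoid_upToTorsion_ofKummerHom_labelwise
    (thetaEnvRecordKummer C hC hS hl hp2 hpl hζ mods f hf hmods h15 L hZ hcharY hlim c hA hfi O ι₀)
    (MulDistribMulAction.toMulAut (Pi C) A) O (fun σ b hb => hO σ b hb)
    (h1LimKummerOn (phi C) (D.lDeltaTheta l) (PiYdd C) c hA hfi O) (phi C) φ₀ (D.lDeltaTheta l) (PiYdd C)
    (MonoidHom.id (Pi C)) (AddEquiv.additiveMultiplicative (h1Lim (phi C) (D.lDeltaTheta l) (PiYdd C) ⊥)) s hι hN hφ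
    (ThetaEnvData.toRecord_constantMonoid _ _ _ _)
    (fun (σ : Pi C) m => h1LimKummerOn_smul (phi C) (D.lDeltaTheta l) (PiYdd C) c hA hfi O σ m
      ⟨σ • (m : A), hO σ m m.2⟩ rfl)
    q (fun x hx a ha => hq x hx a ha) w hsec
    (fun _ _ => rfl) i θ
    (toRecord_topClass (thetaEnvData C hC hS hl hp2 hpl hζ mods f hf hmods h15 L hZ hcharY hlim)
      (CohomologySystemOfContH1.h1LimConjMulAut (phi C) (D.lDeltaTheta l) (PiYdd C))
      (h1LimKummerOn (phi C) (D.lDeltaTheta l) (PiYdd C) c hA hfi O)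
      (fun g : Pi C => h1LimConjEquiv (phi C) (D.lDeltaTheta l) (PiYdd C) (g * ι₀ * g⁻¹))
      (phi C) (D.lDeltaTheta l) (PiYdd C)
      (AddEquiv.additiveMultiplicative (h1Lim (phi C) (D.lDeltaTheta l) (PiYdd C) ⊥)) (fun y _ => ⟨y, rfl⟩) hθ)
    hroots R hR hx t₀ g

end EtaleLevels

end Literature.IUT.HodgeArakelov
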